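import Summits.ResolutionOfSingularities.ResolutionOfSingularities.Theorems.WeightedInvariantJFlatEssSmoothStratum
import Summits.ResolutionOfSingularities.ResolutionOfSingularities.Theorems.WeightedInvariantJFlatEssSmoothCylinder
import Summits.ResolutionOfSingularities.ResolutionOfSingularities.Theorems.WeightedInvariantJFlatEssSmoothMonomial
import Summits.ResolutionOfSingularities.ResolutionOfSingularities.Theorems.WeightedInvariantP3tDrop
import Summits.ResolutionOfSingularities.ResolutionOfSingularities.Theorems.WeightedInvariantRegularParameterExtension
import Literature.AlgebraicGeometry.Resolution.RegularQuotientIdeal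
import Literature.AlgebraicGeometry.Resolution.RsopMonomialIdeals
import HarnessLib

/-!
# (c11)≤3 for the flat centre filtration `J₃ᵗ = Iota3.jFlatT`, PART 4 — THE ASSEMBLY: `jFlatT` commutes with essentially
# smooth local homomorphisms of regular local rings of dimension `≤ 3`, MODULO ⟨(c11τ)≤3, the equal-dimension-3 point branch⟩
# (door `HypersurfaceCentreConstruction`, stmt-ResolutionOfSingularities-19897; P3 rung clause (c11)≤3, J-half of
# `IotaJEssSmoothCompatibleLE 3 p Iota3.iotaFlatT Iota3.jFlatT`; ORDER (o53) of res-L1-w43-plan-1, hand res-L1-w43-stub-3)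

Topic: `Summits/ResolutionOfSingularities/ResolutionOfSingularities/Theorems`. Helper for the door item
`HypersurfaceCentreConstruction` (stmt-ResolutionOfSingularities-19897, route `WeightedInvariant`), line `local-engine`
(L W4.3), def-free.  MEMO `L/res-L1-w43-stub-3/g5/O53-MEMO.md` §3.  `φ : S → S'` local, formally smooth, essentially of finite
type between regular local rings, `dim S' ≤ 3`, `f ∈ S`:

* §1 junk: `iotaTau_zero`, `iotaTau_of_isUnit`, `topStratum_iotaOrdEpsTau_zero/_of_isUnit` (`= univ`), `jFlatCoreE_zero/_of_isUnit`,
  **`jFlatT_zero = ⊥`, `jFlatT_of_isUnit = ⊤`** at regular local positions (the cylinder over the generic point `⊥`).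
* §2 `isRsopPart_of_linearIndependent_toCotangent` (elements with independent differentials are part of a regular system of
  parameters, res-type-005's `RspExtension.exists_rsp_extension` + Mathlib `IsRegularLocalRing.spanFinrank_maximalIdeal`),
  `ringKrullDim_atPrime_span_singleton_le_two`.
* §3 **`jFlatT_map`** — `jFlatT S' (φ f) m = (jFlatT S f m) S'` for every `m`, GIVEN (i) the compatibility of the tie letter `τ`
  with `φ` at the closed point and at every prime of `S'` (`hτ`, `hτpt` = res-type-013's (c11τ)≤3, OPEN) and (ii) the POINT
  BRANCH at equal dimension three (`hpt : 𝔪_S S' = 𝔪_{S'} → dim S = 3 → jFlatCoreE S' (φ f) m = (jFlatCoreE S f m) S'` =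
  GAP 1 `jContact` at equal dimension 3 (ε = 1) ∪ GAP 2 `jSigmaPt` (ε = 0), both OPEN).  Proof: `0 ≠ f ∈ 𝔪` (else §1); the
  generic prime `P₀ᵗ` of the top `(ν ; ε ; τ)`-stratum is prime with regular quotient (res-type-013
  `topStratumPrime_iotaOrdEpsTau_spec`), generated by `c` elements with independent differentials (Literature
  `exists_span_eq_of_isRegularLocalRing_quotient`); the top stratum of `S'` is `V(P₀ S')` (PART 1, from `hτ`/`hτpt`); by `c`:
  `c = 1` PART 2 `cylinderAt_jContact_map_compatible_of_height_one`; `c = 2` PART 2 `cylinderAt_jContact_pair_map_compatible`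
  with «not of monomial type» from PART 3 (LEMMA M), equimultiplicity from the spec, the valuation dichotomy from brk-1/005's
  `Descent.dichotomy_of_ringKrullDim_quotient_eq_one` (`dim S ⧸ P₀ = 1`) or trivially (`P₀ = 𝔪`); `c = 3` both sides are
  `jFlatCoreE` (`jFlatOver_eq_jFlatCoreE`, res-type-061) and `hpt` applies (`𝔪 S' = 𝔪'` by `EssSmoothLE2.map_maximalIdeal_eq_of_ringKrullDim_eq`).

So the J-half of (c11)≤3 for `(iotaFlatT, jFlatT)` is reduced to ⟨(c11τ)≤3, GAP 1, GAP 2⟩ and nothing else — every cylinder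
regime is a THEOREM.

[OURS · L1 W4.3 · (o53)]  Replaces the role of NO printed item; NOT a statement of the manuscript
[claim: Hironaka2017, status: under-review]. AI work, weaker than expert review.  Pure commutative algebra; no named facts.

## References

* H. Matsumura, *Commutative Ring Theory* (1987), Thm. 13.5, 14.2, 15.1, 19.3, 23.7. [Matsumura1987]
-/

noncomputable section

open IsLocalRing Literature.AlgebraicGeometry.Resolution
open Summit.ResolutionOfSingularities.ResolutionOfSingularities.Cruxes.HypersurfaceCentreConstruction.LocalEngine
open Summit.ResolutionOfSingularities.ResolutionOfSingularities.Cruxes.HypersurfaceCentreConstruction.LocalEngine.Iota3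

set_option linter.dupNamespace false -- mandated namespace of this single-conjunct summit

namespace Summit.ResolutionOfSingularities.ResolutionOfSingularities.Theorems

namespace JFlatEssSmooth

open ContactCylinder

/-! ## §1 Junk positions: `f = 0` and units -/

section Junk

/-- `τ(R, 0) = 0`: a tie position has a non-zero equation. [OURS] -/
theorem iotaTau_zero (R : Type) [CommRing R] : iotaTau R 0 = 0 := by
  rw [iotaTau_eq_zero_iff]
  rintro ⟨𝔭, h⟩
  exact h.ne_zero (map_zero _)

/-- `τ(R, u) = 0` for a unit `u`: a tie position has its equation in the maximal ideal. [OURS] -/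
theorem iotaTau_of_isUnit (R : Type) [CommRing R] {f : R} (hf : IsUnit f) : iotaTau R f = 0 := by
  rw [iotaTau_eq_zero_iff]
  rintro ⟨𝔭, h⟩
  haveI := h.isRegularLocalRing
  exact IsLocalRing.notMem_maximalIdeal.mpr (hf.map _) h.mem_maximalIdeal

/-- The top `ι₀`-stratum of `0` is everything. [OURS] -/
theorem topStratum_iotaOrdEpsTau_zero (R : Type) [CommRing R] [IsRegularLocalRing R] :
    topStratum iotaOrdEpsTau R 0 = {𝔮 | (⊥ : Ideal R) ≤ 𝔮.asIdeal} := by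
  ext 𝔮
  simp only [Set.mem_setOf_eq, bot_le, iff_true]
  rw [mem_topStratum_iotaOrdEpsTau_iff, topStratum_iotaOrdEps_zero, map_zero, iotaTau_zero, iotaTau_zero]
  exact ⟨Set.mem_univ _, rfl⟩

/-- The top `ι₀`-stratum of a unit is everything. [OURS] -/
theorem topStratum_iotaOrdEpsTau_of_isUnit (R : Type) [CommRing R] [IsRegularLocalRing R] {f : R} (hf : IsUnit f) :
    topStratum iotaOrdEpsTau R f = {𝔮 | (⊥ : Ideal R) ≤ 𝔮.asIdeal} := by
  ext 𝔮
  simp only [Set.mem_setOf_eq, bot_le, iff_true]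
  rw [mem_topStratum_iotaOrdEpsTau_iff, topStratum_iotaOrdEps_of_isUnit R hf, iotaTau_of_isUnit _ (hf.map _),
    iotaTau_of_isUnit R hf]
  exact ⟨Set.mem_univ _, rfl⟩

/-- `jFlatCoreE R 0 m = ⊥` on a local ring (both branches). [OURS] -/
theorem jFlatCoreE_zero (R : Type) [CommRing R] [IsLocalRing R] (m : ℕ) : jFlatCoreE R 0 m = ⊥ := by
  by_cases h : ringKrullDim R ≤ 2 ∨ iotaEps R (0 : R) = 1
  · rw [jFlatCoreE_of_pos R h, jContact_eq, jContactLocal_zero]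
  · rw [jFlatCoreE_of_neg R h, jSigmaPt_eq, jSigmaPtLocal_zero]

/-- `jFlatCoreE R u m = ⊤` for a unit `u` on a local ring (both branches). [OURS] -/
theorem jFlatCoreE_of_isUnit (R : Type) [CommRing R] [IsLocalRing R] {f : R} (hf : IsUnit f) (m : ℕ) :
    jFlatCoreE R f m = ⊤ := by
  by_cases h : ringKrullDim R ≤ 2 ∨ iotaEps R f = 1
  · rw [jFlatCoreE_of_pos R h, jContact_eq, jContactLocal_of_isUnit hf]
  · rw [jFlatCoreE_of_neg R h, jSigmaPt_eq, jSigmaPtLocal_of_isUnit hf]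

/-- **`jFlatT R 0 m = ⊥`** at a regular local position: the top stratum is everything, its generic prime is `⊥`, and the core
read in the fraction field is `⊥`. [OURS] -/
theorem jFlatT_zero (R : Type) [CommRing R] [IsRegularLocalRing R] (m : ℕ) : jFlatT R 0 m = ⊥ := by
  haveI := isDomain_of_isRegularLocalRing R
  rw [jFlatT_def, jFlatOver_eq_of_topStratum_eq iotaOrdEpsTau R 0 m (topStratum_iotaOrdEpsTau_zero R), map_zero,
    jFlatCoreE_zero]
  exact Ideal.comap_bot_of_injective _
    (IsLocalization.injective (Localization.AtPrime (⊥ : Ideal R)) (Ideal.primeCompl_le_nonZeroDivisors (⊥ : Ideal R)))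

/-- **`jFlatT R u m = ⊤`** for a unit `u` at a regular local position. [OURS] -/
theorem jFlatT_of_isUnit (R : Type) [CommRing R] [IsRegularLocalRing R] {f : R} (hf : IsUnit f) (m : ℕ) :
    jFlatT R f m = ⊤ := by
  haveI := isDomain_of_isRegularLocalRing R
  rw [jFlatT_def, jFlatOver_eq_of_topStratum_eq iotaOrdEpsTau R f m (topStratum_iotaOrdEpsTau_of_isUnit R hf),
    jFlatCoreE_of_isUnit _ (hf.map _), Ideal.comap_top]

end Junk

/-! ## §2 Elements with independent differentials are part of a regular system of parameters -/

section Rsop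

/-- **Independent differentials ⇒ part of a regular system of parameters** (Matsumura 14.2): extend to a minimal basis of `𝔪`
(res-type-005's `RspExtension.exists_rsp_extension`) and count (`IsRegularLocalRing.spanFinrank_maximalIdeal`).
[cite: Matsumura1987, Thm. 14.2] -/
theorem isRsopPart_of_linearIndependent_toCotangent {S : Type} [CommRing S] [IsRegularLocalRing S] {c : ℕ} (u : Fin c → S)
    (hu : ∀ i, u i ∈ maximalIdeal S)
    (hli : LinearIndependent (ResidueField S) fun i => (maximalIdeal S).toCotangent ⟨u i, hu i⟩) : IsRsopPart u := by
  obtain ⟨r, y, -, hspan, hrk⟩ := RspExtension.exists_rsp_extension S u hu hli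
  refine ⟨inferInstance, r, y, ?_, ?_⟩
  · rw [← IsRegularLocalRing.spanFinrank_maximalIdeal, hrk]
  · rw [← hspan]
    congr 1
    ext a
    constructor
    · rintro (⟨j, rfl⟩ | ⟨j, rfl⟩)
      · exact ⟨Fin.castAdd r j, by simp⟩
      · exact ⟨Fin.natAdd c j, by simp⟩
    · rintro ⟨i, rfl⟩
      induction i using Fin.addCases with
      | left j => exact Or.inl ⟨j, by simp⟩
      | right j => exact Or.inr ⟨j, by simp⟩

/-- `dim R_𝔮 ≤ 2` (indeed `≤ 1`) for a prime `𝔮 = (a)` of a Noetherian ring (Krull). [cite: Matsumura1987, Thm. 13.5] -/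
theorem ringKrullDim_atPrime_span_singleton_le_two {R : Type} [CommRing R] [IsNoetherianRing R] (a : R)
    [(Ideal.span {a}).IsPrime] : ringKrullDim (Localization.AtPrime (Ideal.span {a})) ≤ 2 := by
  rw [IsLocalization.AtPrime.ringKrullDim_eq_height (Ideal.span {a}) (Localization.AtPrime (Ideal.span {a}))]
  have h1 : (Ideal.span {a}).height ≤ (Ideal.span {a}).spanFinrank :=
    Ideal.height_le_spanFinrank _ (Ideal.IsPrime.ne_top ‹_›)
  have h2 : (Ideal.span ({a} : Set R)).spanFinrank ≤ 2 := by
    refine (Submodule.spanFinrank_span_le_ncard_of_finite (Set.toFinite _)).trans ?_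
    rw [Set.ncard_singleton]; omega
  have h2' : ((Ideal.span ({a} : Set R)).spanFinrank : ℕ∞) ≤ 2 := by exact_mod_cast h2
  exact (WithBot.coe_le_coe.mpr (h1.trans h2')).trans_eq (WithBot.coe_ofNat 2)

end Rsop

/-- `x + 2 = 3` in `WithBot ℕ∞` forces `x = 1`. [folklore] -/
theorem eq_one_of_add_two_eq {x : WithBot ℕ∞} (h : x + 2 = 3) : x = 1 := by
  induction x using WithBot.recBotCoe with
  | bot => exact absurd h (by simp)
  | coe a =>
    have h2 : a + 2 = 3 := by
      rw [show (2 : WithBot ℕ∞) = ((2 : ℕ∞) : WithBot ℕ∞) from rfl,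
        show (3 : WithBot ℕ∞) = ((3 : ℕ∞) : WithBot ℕ∞) from rfl, ← WithBot.coe_add, WithBot.coe_inj] at h
      exact h
    induction a using ENat.recTopCoe with
    | top => exact absurd h2 (by simp)
    | coe n =>
      have h3 : n + 2 = 3 := by exact_mod_cast h2
      have hn : n = 1 := by omega
      subst hn
      simp

/-! ## §3 The assembly -/

section Assembly

variable (S S' : Type) [CommRing S] [IsRegularLocalRing S] [CommRing S'] [IsRegularLocalRing S'] [Algebra S S']
  [IsLocalHom (algebraMap S S')] [Algebra.FormallySmooth S S'] [Algebra.EssFiniteType S S']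

/-- **(c11)≤3, J-HALF, FOR `J₃ᵗ = Iota3.jFlatT`, MODULO ⟨(c11τ)≤3, the equal-dimension-3 point branch⟩.**  `φ : S → S'` local,
formally smooth, essentially of finite type between regular local rings with `dim S' ≤ 3`; `f ∈ S`.  ASSUME (i) the tie letter
`τ` is compatible with `φ` at the closed point (`hτ`) and at every prime of `S'` (`hτpt`) — res-type-013's (c11τ)≤3 — and (ii)
when `𝔪_S S' = 𝔪_{S'}` and `dim S = 3` the ε-switched core `jFlatCoreE` is compatible with `φ` at `f` (`hpt`: GAP 1 `jContact`
at equal dimension three / GAP 2 `jSigmaPt`).  THEN `jFlatT S' (φ f) m = (jFlatT S f m) S'` for every `m` — every other regime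
(junk, divisorial `ht P₀ = 1`, curve / surface-into-threefold `ht P₀ = 2`) is a theorem of PARTS 1–3. [OURS · L1 W4.3 · (o53)] -/
theorem jFlatT_map (hdimS' : ringKrullDim S' ≤ 3) (f : S)
    (hτ : iotaTau S' (algebraMap S S' f) = iotaTau S f)
    (hτpt : ∀ (𝔮' : Ideal S') [𝔮'.IsPrime], iotaTau (Localization.AtPrime 𝔮') (algebraMap S (Localization.AtPrime 𝔮') f) =
      iotaTau (Localization.AtPrime (𝔮'.comap (algebraMap S S')))
        (algebraMap S (Localization.AtPrime (𝔮'.comap (algebraMap S S'))) f))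
    (hpt : (maximalIdeal S).map (algebraMap S S') = maximalIdeal S' → ringKrullDim S = (3 : ℕ) →
      ∀ m : ℕ, jFlatCoreE S' (algebraMap S S' f) m = (jFlatCoreE S f m).map (algebraMap S S'))
    (m : ℕ) :
    jFlatT S' (algebraMap S S' f) m = (jFlatT S f m).map (algebraMap S S') := by
  classical
  haveI := isDomain_of_isRegularLocalRing S
  haveI := isDomain_of_isRegularLocalRing S'
  -- junk positions
  by_cases hf0 : f = 0
  · subst hf0
    rw [map_zero, jFlatT_zero, jFlatT_zero, Ideal.map_bot]
  by_cases hfu : IsUnit f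
  · rw [jFlatT_of_isUnit S' (hfu.map _), jFlatT_of_isUnit S hfu, Ideal.map_top]
  have hf : f ∈ maximalIdeal S := (IsLocalRing.mem_maximalIdeal f).mpr hfu
  have hf0' : algebraMap S S' f ≠ 0 := fun h =>
    hf0 (EssSmoothDescent.algebraMap_injective (S := S) (S' := S') (by rw [h, map_zero]))
  -- dimensions as natural numbers
  obtain ⟨dS, dS', dF, hdS, hdS', -, hdd⟩ := EssSmoothLE2.exists_dims S S'
  have hdS'3 : dS' ≤ 3 := by
    have := hdS' ▸ hdimS'
    exact_mod_cast this
  have hdimS : ringKrullDim S ≤ 3 := by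
    rw [hdS]; exact_mod_cast (show dS ≤ 3 by omega)
  -- the order and the generic prime `P₀` of the top `ι₀`-stratum
  obtain ⟨-, hfν, hfν1⟩ := EssSmoothLevels.adicOrder_toNat_spec hf0 hf
  have hν : iotaOrd S f = ((adicOrder f).toNat : ℕ) := (iotaOrd_eq_natCast_iff S f _).mpr ⟨hfν, hfν1⟩
  obtain ⟨hP₀, hreg, hfP₀, hE, hiff, -⟩ := topStratumPrime_iotaOrdEpsTau_spec hdimS hf0 hf hν
  set P₀ := topStratumPrime iotaOrdEpsTau S f with hP₀def
  haveI := hP₀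
  haveI := hreg
  -- the top stratum of `S'`
  haveI hP₀' : (P₀.map (algebraMap S S')).IsPrime := isPrime_map_of_isRegularLocalRing_quotient S S' P₀ hreg
  have hE' : topStratum iotaOrdEpsTau S' (algebraMap S S' f) = {𝔮' | P₀.map (algebraMap S S') ≤ 𝔮'.asIdeal} :=
    topStratum_iotaOrdEpsTau_map_of_eq S S' f hτ hτpt hE
  -- generators of `P₀` with independent differentials
  have hP₀𝔪 : P₀ ≤ maximalIdeal S := IsLocalRing.le_maximalIdeal hP₀.ne_top
  obtain ⟨c, u, hu₀, hspan, hli⟩ := exists_span_eq_of_isRegularLocalRing_quotient hP₀𝔪 (P₀ : Set S) (Ideal.span_eq P₀)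
  have hu : ∀ i, u i ∈ maximalIdeal S := fun i => hP₀𝔪 (hu₀ i)
  have hrs : IsRsopPart u := isRsopPart_of_linearIndependent_toCotangent u hu hli
  obtain ⟨-, e, y, hde, hspan𝔪⟩ := hrs
  have hce : c + e = dS := by
    have := hdS ▸ hde
    exact_mod_cast this.symm
  -- when `e = 0` the top stratum is the closed point
  have hP₀max : e = 0 → P₀ = maximalIdeal S := by
    intro he
    subst he
    rw [← hspan, ← hspan𝔪, Set.range_eq_empty y, Set.union_empty]
  -- case analysis on `c = ht P₀`
  rcases (by omega : c = 0 ∨ c = 1 ∨ c = 2 ∨ c = 3 ∨ 4 ≤ c) with rfl | rfl | rfl | rfl | hc4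
  · -- `c = 0`: `P₀ = ⊥ ∋ f`, `f = 0`
    exfalso
    rw [← hspan, Set.range_eq_empty u, Ideal.span_empty] at hfP₀
    exact hf0 ((Submodule.mem_bot S).mp hfP₀)
  · -- `c = 1`: the divisorial case
    have hrange : Set.range u = {u 0} := by
      ext a; constructor
      · rintro ⟨i, rfl⟩; rw [Set.mem_singleton_iff, Fin.fin_one_eq_zero i]
      · rintro rfl; exact ⟨0, rfl⟩
    rw [hrange] at hspan
    haveI : (Ideal.span {u 0}).IsPrime := by rw [hspan]; exact hP₀
    haveI : (Ideal.span {algebraMap S S' (u 0)}).IsPrime := by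
      rw [← Set.image_singleton, ← Ideal.map_span, hspan]; exact hP₀'
    have hx2 : u 0 ∉ maximalIdeal S ^ 2 :=
      IsRsopPart.not_mem_sq (isRsopPart_of_linearIndependent_toCotangent u hu hli) 0
    have hES : topStratum iotaOrdEpsTau S f = {𝔮 | Ideal.span {u 0} ≤ 𝔮.asIdeal} := by rw [hspan]; exact hE
    have hES' : topStratum iotaOrdEpsTau S' (algebraMap S S' f) =
        {𝔮' | Ideal.span {algebraMap S S' (u 0)} ≤ 𝔮'.asIdeal} := by
      rw [← Set.image_singleton, ← Ideal.map_span, hspan]; exact hE'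
    rw [jFlatT_eq_cylinderAt_jContact S' (algebraMap S S' f) m hES' (ringKrullDim_atPrime_span_singleton_le_two _),
      jFlatT_eq_cylinderAt_jContact S f m hES (ringKrullDim_atPrime_span_singleton_le_two _)]
    have hfP : f ∈ Ideal.span {u 0} := by rw [hspan]; exact hfP₀
    exact cylinderAt_jContact_map_compatible_of_height_one S S' (Ideal.span {u 0}) (u 0) (hu 0) hx2 rfl f hf0 hfP _
      (by rw [Ideal.map_span, Set.image_singleton]) m
  · -- `c = 2`: the cylinder over a regular pair
    have hrange : Set.range u = {u 0, u 1} := by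
      ext a; constructor
      · rintro ⟨i, rfl⟩; fin_cases i <;> simp
      · rintro (rfl | rfl) <;> exact ⟨_, rfl⟩
    rw [hrange] at hspan
    haveI : (Ideal.span {u 0, u 1}).IsPrime := by rw [hspan]; exact hP₀
    haveI : (Ideal.span {algebraMap S S' (u 0), algebraMap S S' (u 1)}).IsPrime := by
      rw [span_pair_map_eq_map, hspan]; exact hP₀'
    have hxg : ∀ i, (![u 0, u 1] : Fin 2 → S) i ∈ maximalIdeal S := fun i => by fin_cases i <;> exact hu _
    have hli2 : LinearIndependent (ResidueField S)
        (fun i => (maximalIdeal S).toCotangent ⟨(![u 0, u 1] : Fin 2 → S) i, hxg i⟩) := by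
      convert hli using 1
      funext i; fin_cases i <;> rfl
    have hES : topStratum iotaOrdEpsTau S f = {𝔮 | Ideal.span {u 0, u 1} ≤ 𝔮.asIdeal} := by rw [hspan]; exact hE
    have hES' : topStratum iotaOrdEpsTau S' (algebraMap S S' f) =
        {𝔮' | Ideal.span {algebraMap S S' (u 0), algebraMap S S' (u 1)} ≤ 𝔮'.asIdeal} := by
      rw [span_pair_map_eq_map, hspan]; exact hE'
    -- not of monomial type (LEMMA M), equimultiple (the spec), the valuation dichotomy
    have hnm := not_isMonomialType_of_topStratumPrime_eq hdimS hf0 hf (u 0) (u 1) hxg hli2 hspan.symm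
    haveI : IsRegularLocalRing (Localization.AtPrime (Ideal.span {u 0, u 1})) := isRegularLocalRing_localization_atPrime S _
    have hfP : f ∈ Ideal.span {u 0, u 1} := by rw [hspan]; exact hfP₀
    have hf0P : algebraMap S (Localization.AtPrime (Ideal.span {u 0, u 1})) f ≠ 0 := fun h =>
      hf0 (IsLocalization.injective (Localization.AtPrime (Ideal.span {u 0, u 1}))
        (Ideal.primeCompl_le_nonZeroDivisors (Ideal.span {u 0, u 1})) (by rw [h, map_zero]))
    have hordP : iotaOrd (Localization.AtPrime (Ideal.span {u 0, u 1}))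
        (algebraMap S (Localization.AtPrime (Ideal.span {u 0, u 1})) f) = ((adicOrder f).toNat : ℕ) := by
      rw [← hν]
      have h := (hiff (Ideal.span {u 0, u 1}) hfP).mpr hspan.ge
      rw [iotaOrdEpsTau_eq_iff, iotaOrdEps_eq_iff] at h
      exact h.1.1
    have hfmP : algebraMap S (Localization.AtPrime (Ideal.span {u 0, u 1})) f ∈
        maximalIdeal (Localization.AtPrime (Ideal.span {u 0, u 1})) :=
      (IsLocalization.AtPrime.to_map_mem_maximal_iff (Localization.AtPrime (Ideal.span {u 0, u 1})) (Ideal.span {u 0, u 1}) f).mpr hfP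
    have heq : f ∉ maximalIdeal S ^
        ((adicOrder (algebraMap S (Localization.AtPrime (Ideal.span {u 0, u 1})) f)).toNat + 1) := by
      obtain ⟨-, h1, h2⟩ := EssSmoothLevels.adicOrder_toNat_spec hf0P hfmP
      have hordP' := (iotaOrd_eq_natCast_iff _ _ _).mpr ⟨h1, h2⟩
      rw [hordP, Nat.cast_inj] at hordP'
      rw [← hordP']
      exact hfν1
    have hval : ∀ a b : S, b ∉ Ideal.span {u 0, u 1} →
        ∃ c : S, a - b * c ∈ Ideal.span {u 0, u 1} ∨ (c ∈ maximalIdeal S ∧ b - a * c ∈ Ideal.span {u 0, u 1}) := by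
      rcases Nat.eq_zero_or_pos e with he | he
      · -- `P₀ = 𝔪`: `b` is a unit
        intro a b hb
        have hmax : Ideal.span {u 0, u 1} = maximalIdeal S := hspan.trans (hP₀max he)
        rw [hmax] at hb ⊢
        obtain ⟨b', hb'⟩ := (IsLocalRing.notMem_maximalIdeal.mp hb).exists_left_inv
        exact ⟨b' * a, Or.inl (by rw [← mul_assoc, mul_comm b b', hb', one_mul, sub_self]; exact Ideal.zero_mem _)⟩
      · -- `dim S ⧸ P₀ = 1`: the quotient is a discrete valuation ring
        have he1 : e = 1 := by omega
        have hquot : ringKrullDim (S ⧸ Ideal.span {u 0, u 1}) = 1 := by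
          have h := IsRsopPart.ringKrullDim_quotient_add (isRsopPart_of_linearIndependent_toCotangent u hu hli)
          rw [hrange, hde, he1] at h
          -- `h : dim (S ⧸ P₀) + 2 = 2 + 1` in `WithBot ℕ∞`
          norm_num at h
          exact eq_one_of_add_two_eq h
        intro a b _
        haveI : IsRegularLocalRing (S ⧸ Ideal.span {u 0, u 1}) := by rw [hspan]; exact hreg
        exact Descent.dichotomy_of_ringKrullDim_quotient_eq_one (Ideal.span {u 0, u 1}) inferInstance hquot a b
    rw [jFlatT_eq_cylinderAt_jContact S' (algebraMap S S' f) m hES' (ringKrullDim_atPrime_span_pair_le_two _ _),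
      jFlatT_eq_cylinderAt_jContact S f m hES (ringKrullDim_atPrime_span_pair_le_two _ _)]
    exact cylinderAt_jContact_pair_map_compatible S S' (Ideal.span {u 0, u 1}) (u 0) (u 1) hxg hli2 rfl hval f hf0P hfP hnm
      heq _ (span_pair_map_eq_map S S' (u 0) (u 1)).symm m
  · -- `c = 3`: the point branch at equal dimension three
    have he : e = 0 := by omega
    have hP₀𝔪' : P₀ = maximalIdeal S := hP₀max he
    have hdS3 : ringKrullDim S = (3 : ℕ) := by rw [hdS, ← hce, he]
    have hdims : ringKrullDim S = ringKrullDim S' := by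
      rw [hdS, hdS']
      have : dS = dS' := by omega
      rw [this]
    have h𝔪 := EssSmoothLE2.map_maximalIdeal_eq_of_ringKrullDim_eq S S' hdims
    have hP₀S' : topStratumPrime iotaOrdEpsTau S' (algebraMap S S' f) = maximalIdeal S' := by
      rw [topStratumPrime_eq_of_topStratum_eq iotaOrdEpsTau S' _ hE', hP₀𝔪', h𝔪]
    rw [jFlatT_def, jFlatT_def, jFlatOver_eq_jFlatCoreE iotaOrdEpsTau S' _ m hP₀S',
      jFlatOver_eq_jFlatCoreE iotaOrdEpsTau S f m hP₀𝔪']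
    exact hpt h𝔪 hdS3 m
  · -- `c ≥ 4`: impossible in dimension `≤ 3`
    exfalso; omega

end Assembly

end JFlatEssSmooth

end Summit.ResolutionOfSingularities.ResolutionOfSingularities.Theorems

end
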